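import Summits.ResolutionOfSingularities.ResolutionOfSingularities.Theorems.WallFrames15
import Summits.ResolutionOfSingularities.ResolutionOfSingularities.Theorems.NearCutCompanion3
import Summits.ResolutionOfSingularities.ResolutionOfSingularities.Theorems.NearCutWalls2
import Summits.ResolutionOfSingularities.ResolutionOfSingularities.Theorems.ProximityCutArcLaw
import Summits.ResolutionOfSingularities.ResolutionOfSingularities.Theorems.MaxContactCutBoundaryLedger
import Summits.ResolutionOfSingularities.ResolutionOfSingularities.Theorems.MaxContactCutWallCut
import Summits.ResolutionOfSingularities.ResolutionOfSingularities.Theorems.PlanarGhostDescent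
import Literature.AlgebraicGeometry.Resolution.PointBlowupIFPGiraud
import Literature.AlgebraicGeometry.Resolution.AdicNoetherian
import HarnessLib

/-!
# WallFrames (16/17) — Kollár's wall descent in a polynomial frame; sections: Port

Verbatim slice of the farm-checked monolith `WallFrames.lean` of cell `decomp-res`, seat `decomp-res-lens-5`, g35
(sha256 7405a21d81d102a4…, monolith lines 3703–3876); one namespace `Summit.ResolutionOfSingularities.ResolutionOfSingularities.Theorems.WallFrames` across the
slices, imports chained.  The monolith's module docstring (laws W1–W7, mechanism, novelty, honest placement) is
reproduced in slice 1; the main theorem `balancedWallPort_holds : WallCut.BalancedWallPort` (hypothesis-free) and the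
host-route corollary `ecBalancedWallPort_holds` (aside item 27368 of route MaxContactCut) are in slice 16/17.
-/

open MvPolynomial Finset
open scoped BigOperators
open Literature.AlgebraicGeometry.Resolution
open Literature.AlgebraicGeometry.Resolution.Hauser2010
open Literature.AlgebraicGeometry.Resolution.PointBlowup
open Literature.AlgebraicGeometry.Resolution.HauserPerlega2024

namespace Summit.ResolutionOfSingularities.ResolutionOfSingularities.Theorems.WallFrames

variable {σ : Type*} [Fintype σ] [DecidableEq σ] {K : Type*} [Field K]

section Port

/-- **`BalancedWallPort` HOLDS.** [new] -/
theorem balancedWallPort_holds : WallCut.BalancedWallPort := by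
  intro p hp e K _ _ _ _ s₀ hroot W N hplat hrec s hsh hs2 hsq hqs hnd hbal
  classical
  haveI : Fact p.Prime := ⟨hp⟩
  exfalso
  have hs : s ≠ 0 := by omega
  have hs1 : 1 ≤ s := by omega
  have hsL : (s : K) ≠ 0 := fun h => hnd ((CharP.cast_eq_zero_iff K p s).mp h)
  have hshade : ∀ t, N ≤ t → (W.st t).shade = (s : ℕ∞) := NearCut.shade_of_plateau W N s hplat hsh
  have hbig : ∀ t, N ≤ t → ordZero (W.st t).F ≠ ((p ^ e : ℕ) : ℕ∞) := by
    intro t ht h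
    have ho := NearCut.ordZero_eq_degree_add hroot W t s (hshade t ht)
    rw [ho] at h
    have h' : (W.st t).r.degree + s = p ^ e := by exact_mod_cast h
    have := (hbal t ht).1
    omega
  have hinv := NearCut.tailInv_of_balanced hp hroot W N hplat hbig s hsh hbal
  have hGs : ∀ n, ordZero (NearCut.companion W N s n) = (s : ℕ∞) := fun n => by
    obtain ⟨-, -, -, -, -, h⟩ := hinv n; exact h
  -- the layer law (body of `NearCut.companionLaw`, which needs no hypothesis on `e`)
  have hlay : ∀ n, ∃ c : K, c ≠ 0 ∧ homogeneousComponent ((W.st (N + n)).r.degree + s) (W.st (N + n)).F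
      = C c * (monomial (W.st (N + n)).r 1 * homogeneousComponent s (NearCut.companion W N s n)) := by
    intro n
    obtain ⟨U, Cq, hU, hCq, hF, hord⟩ := hinv n
    refine ⟨constantCoeff U, hU, ?_⟩
    have hslt : s < p ^ e :=
      NearCut.lt_of_balanced hroot W (N + n) s (hshade _ (by omega)) (hbig _ (by omega)) (hbal _ (by omega)).1
    obtain ⟨y₁, y₂, hy, h1, h2⟩ := NearCut.two_walls (hbal (N + n) (by omega)).2
    exact NearCut.layer_of_structure (δ := p ^ e - s) (by omega) (by omega) (by omega)
      (ItineraryCutClasses.walk_clean hroot W (N + n)) hCq hF hord.ge hy h1 h2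
  -- the directrix data (pattern of `NearCut.noBalancedTails_of_pieces`)
  have hbig' : ∀ t, N ≤ t → ((p ^ e : ℕ) : ℕ∞) < ordZero (W.st t).F := fun t ht =>
    lt_of_le_of_ne (ItineraryCutClasses.walk_ord hroot W t) (fun h => hbig t ht h.symm)
  have hdir : ∀ n, ∃ (c : K) (ℓ : MvPolynomial (Fin 3) K), c ≠ 0 ∧ ℓ.IsHomogeneous 1 ∧ ℓ ≠ 0 ∧
      homogeneousComponent s (NearCut.companion W N s n) = C c * ℓ ^ s := by
    intro n
    obtain ⟨c₁, hc₁, hlay1⟩ := hlay n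
    obtain ⟨o, ho, -⟩ := ItineraryCutClasses.walk_nat hroot W (N + n)
    obtain ⟨s', hs', hos⟩ := BoundaryLedger.order_eq_shade_add_degree hroot W (N + n) ho
    have hss : s' = s := by
      have h := hs'.symm.trans (hshade (N + n) (by omega)); exact_mod_cast h
    obtain ⟨c₂, ℓ, hc₂, hℓ1, hℓ0, hid⟩ :=
      NearCut.directrix_of_plateau hroot W N hplat hbig' hrec hsh (N + n) (by omega) o ho
    rw [show o = (W.st (N + n)).r.degree + s by omega, hlay1] at hid
    have hyr : (monomial (W.st (N + n)).r (1 : K)) ≠ 0 := fun h => one_ne_zero (monomial_eq_zero.mp h)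
    have h1 : monomial (W.st (N + n)).r (1 : K) * homogeneousComponent s (NearCut.companion W N s n)
        = monomial (W.st (N + n)).r (1 : K) * (C (c₁⁻¹ * c₂) * ℓ ^ s) := by
      have h : C c₁⁻¹ * (C c₁ * (monomial (W.st (N + n)).r (1 : K) *
          homogeneousComponent s (NearCut.companion W N s n)))
          = C c₁⁻¹ * (C c₂ * (monomial (W.st (N + n)).r 1 * ℓ ^ s)) := by rw [hid]
      rw [← mul_assoc, ← map_mul, inv_mul_cancel₀ hc₁, map_one, one_mul] at h
      rw [h, map_mul]; ring
    exact ⟨c₁⁻¹ * c₂, ℓ, mul_ne_zero (inv_ne_zero hc₁) hc₂, hℓ1, hℓ0, mul_left_cancel₀ hyr h1⟩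
  choose c ℓ hc hℓ1 hℓ0 hin using hdir
  -- the free letter
  have hfx : ∀ n, ∃ x, (W.st (N + n)).r x = 0 := fun n => by
    obtain ⟨x, hx, -⟩ := (hbal (N + n) (by omega)).2; exact ⟨x, hx⟩
  choose f hf using hfx
  -- transversality, lineage, slots
  have htrans := transversal hroot W N s hs hshade hbig hbal hGs c ℓ hc hℓ1 hℓ0 hin f hf hrec
  have hlinF := lineage_facts hroot W N s hs hsL hshade hbig hbal hGs c ℓ hc hℓ1 hin f hf htrans
  have hlin : ∀ n, constantCoeff (lineage W N s (f 0) n) = 0 ∧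
      coeff (Finsupp.single (f n) 1) (lineage W N s (f 0) n) ≠ 0 := fun n => ⟨(hlinF n).2.1, (hlinF n).2.2.1⟩
  obtain ⟨w, S1, S2, hI6, hII, hsw⟩ := toric_slots hroot W N s hshade hbig hbal f hf
  have hI : ∀ τ, S1 τ ≠ S2 τ ∧ S1 τ ≠ f τ ∧ S2 τ ≠ f τ ∧ (∀ i, i = f τ ∨ i = S1 τ ∨ i = S2 τ) := fun τ =>
    ⟨(hI6 τ).1, (hI6 τ).2.1, (hI6 τ).2.2.1, (hI6 τ).2.2.2.1⟩
  -- the word switches infinitely often, hence has both letters infinitely often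
  have hswall : ∀ M, ∃ t, M ≤ t ∧ w (t + 1) ≠ w t := by
    intro M
    obtain ⟨t, ht, hst⟩ := hrec (N + M)
    refine ⟨t - N, by omega, hsw (t - N) ?_⟩
    rw [show N + (t - N) = t by omega]; exact hst
  obtain ⟨hUl, hVl⟩ := ExtinctionCut.both_letters_of_switches w hswall
  obtain ⟨tU, -, htU⟩ := hUl 0
  obtain ⟨tV, -, htV⟩ := hVl 0
  -- the horizon and the isolation exponent there
  set T := max tU tV + s + 1 with hTdef
  obtain ⟨M, giso, hg0, hgI⟩ := W.isolated (N + T)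
  -- shifted initial exponents
  set x₀ : (Fin 3 →₀ ℕ) → ℤ × ℤ := fun a =>
    (((a (S1 0) : ℕ) : ℤ) - ((s : ℤ) - a (f 0)), ((a (S2 0) : ℕ) : ℤ) - ((s : ℤ) - a (f 0))) with hx₀def
  have hx₀ : ∀ a, x₀ a = (((a (S1 0) : ℕ) : ℤ) - ((s : ℤ) - a (f 0)), ((a (S2 0) : ℕ) : ℤ) - ((s : ℤ) - a (f 0))) :=
    fun a => rfl
  -- the chain at budget `Λ₀ = s T + (M + 1 + q)`
  obtain ⟨ζ₀, hζ₀, hζ₀1, hζ₀D, hch⟩ :=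
    presentation_chain_at W N s hs hGs f hlin w S1 S2 hI hII (s * T + (M + 1 + p ^ e)) x₀ hx₀
  set A := (zshear (f 0) ζ₀ (NearCut.companion W N s 0)).support.filter
    (fun n => n.degree < s * T + (M + 1 + p ^ e) + n (f 0)) with hAdef
  -- the potential bound AT ALL TIMES for the indices of `A` (chains at every budget + coefficient stability)
  have hσ : ∀ a ∈ A, ∀ t, -(s : ℤ) ≤ (ExtinctionCut.orbit w (x₀ a) t).1 + (ExtinctionCut.orbit w (x₀ a) t).2 := by
    intro a ha t
    obtain ⟨ha1, ha2⟩ := Finset.mem_filter.mp ha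
    obtain ⟨ζ₁, hζ₁, hζ₁1, hζ₁D, hch1⟩ :=
      presentation_chain_at W N s hs hGs f hlin w S1 S2 hI hII (s * t + (s * T + (M + 1 + p ^ e))) x₀ hx₀
    have hε := jet_unique (hlin 0).2 hζ₀ hζ₀1 hζ₁1 (D := s * T + (M + 1 + p ^ e) + 1) hζ₀D
      (le_trans (by exact_mod_cast (by omega)) hζ₁D)
    have hεfree := varFree_sub hζ₁ hζ₀
    have hεΛ : ∀ d ∈ (ζ₁ - ζ₀).support, s * T + (M + 1 + p ^ e) ≤ d.degree := by
      intro d hd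
      by_contra hlt
      exact (mem_support_iff.mp hd)
        ((natCast_le_ordZero_iff_forall_coeff _ _).mp hε d (by omega))
    have hcoeff : coeff a (zshear (f 0) ζ₁ (NearCut.companion W N s 0)) =
        coeff a (zshear (f 0) ζ₀ (NearCut.companion W N s 0)) := by
      rw [show ζ₁ = ζ₀ + (ζ₁ - ζ₀) by ring]
      exact coeff_zshear_stable hζ₀ hεfree hεΛ _ ha2
    have haA1 : a ∈ (zshear (f 0) ζ₁ (NearCut.companion W N s 0)).support.filter
        (fun n => n.degree < s * t + (s * T + (M + 1 + p ^ e)) + n (f 0)) := by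
      refine Finset.mem_filter.mpr ⟨?_, by omega⟩
      rw [mem_support_iff, hcoeff]; exact mem_support_iff.mp ha1
    obtain ⟨ζ, ι, Uα, R, hζ, hζ1, -, hι, hU, hR, hpres, htor⟩ := hch1 t (by omega)
    have hR1 : ∀ d ∈ R.support, (s * T + (M + 1 + p ^ e)) + d (f t) ≤ d.degree := by
      intro d hd; have := hR d hd; rwa [Nat.add_sub_cancel_left] at this
    have hK2 := degree_ge_of_mem_presentation (s := s) _ ι Uα R hι hU
      (fun d hd => by have := hR1 d hd; omega)
      (by rw [← hpres, ordZero_zshear hζ hζ1]; exact (hGs t).ge) a haA1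
    obtain ⟨haf, h1, h2⟩ := htor a haA1
    have hdg := degree_eq_of_three (hI t).2.1.symm (hI t).2.2.1.symm (hI t).1 (hI t).2.2.2 (ι a)
    rw [← h1, ← h2]
    omega
  -- absorption by the horizon
  have hquad : ∀ a ∈ A, ExtinctionCut.InQuad (ExtinctionCut.orbit w (x₀ a) T) := fun a ha =>
    ExtinctionCut.extinction (n := s) (hσ a ha) hUl hVl
      ⟨show -(s : ℤ) ≤ ((a (S1 0) : ℕ) : ℤ) - ((s : ℤ) - a (f 0)) by omega,
       show -(s : ℤ) ≤ ((a (S2 0) : ℕ) : ℤ) - ((s : ℤ) - a (f 0)) by omega⟩ htU htV T (by omega)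
  -- the presentation at the horizon
  obtain ⟨ζ, ι, Uα, R, hζ, hζ1, -, hι, hU, hR, hpres, htor⟩ := hch T (by omega)
  have hR' : ∀ d ∈ R.support, (M + 1 + p ^ e) + d (f T) ≤ d.degree := by
    intro d hd
    have := hR d hd
    rwa [Nat.add_sub_cancel_left] at this
  obtain ⟨U, Cq, hU0, hCq, hF, -⟩ := hinv T
  obtain ⟨h12, h1f, h2f, hexh, hr1, -⟩ := hI6 T
  have hCq' : ∀ d : Fin 3 →₀ ℕ, d ≠ 0 → d.degree < p ^ e → hasseDeriv K d Cq = 0 := by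
    intro d hd0 hdq
    have hex : ∃ i, d i ≠ 0 := by
      by_contra h
      push Not at h
      exact hd0 (Finsupp.ext h)
    obtain ⟨i, hi⟩ := hex
    refine NearCut.hasseDeriv_eq_zero_of_isQPoly e hCq ⟨i, fun hdvd => ?_⟩
    have h1 := Nat.le_of_dvd (Nat.pos_of_ne_zero hi) hdvd
    have h2 : d i ≤ d.degree := by
      have := degree_eq_of_three h1f.symm h2f.symm h12 hexh d
      rcases hexh i with h | h | h <;> rw [h] <;> omega
    omega
  have hnear : ∀ a ∈ A, s ≤ ι a (S1 T) + ι a (f T) := by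
    intro a ha
    obtain ⟨haf, h1, -⟩ := htor a ha
    have hq := hquad a ha
    unfold ExtinctionCut.InQuad at hq
    rw [← h1] at hq
    omega
  exact no_isolation_of_presentation h12.symm h2f h1f
    (fun i => by
      rcases hexh i with h | h | h
      · exact Or.inr (Or.inr h)
      · exact Or.inr (Or.inl h)
      · exact Or.inl h)
    hζ hζ1 (q := p ^ e) (s := s) (M := M) (r := (W.st (N + T)).r) (by rw [hr1]; omega) hF hCq' hpres hnear hR'
    hg0 (hgI (S2 T))

/-- The same, under the host route's name. -/
theorem ecBalancedWallPort_holds :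
    Summit.ResolutionOfSingularities.ResolutionOfSingularities.Theses.MaxContactCut.ECBalancedWallPort :=
  balancedWallPort_holds

end Port

/-! ## §24 CONSEQUENCES THROUGH THE LANDED WIRING (no new mathematics): Kollár's wall port, the two tame balanced
cells, and the EXACT residual of the host aside `MaxContactCut.DefectWalksDeep` = `LOSSY ∧ WILD-BALANCED`. -/

end Summit.ResolutionOfSingularities.ResolutionOfSingularities.Theorems.WallFrames
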